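import Literature.NumberTheory.EllipticCurves.PAdicLFunctionSplitRiemannSumCertificateProofs
import Mathlib.Data.Nat.Choose.Lucas
import HarnessLib

/-!
# Riemann-sum certificates MODULO `p` for the coefficients of `L_p(E,T)` below degree `pⁿ`
# (Mazur–Tate–Teitelbaum's compatibility `P_{n+1} ≡ P_n mod ω_n`; theorems only — no definition,
# no named fact)

The tree's Riemann-sum certificate theorems (`PAdicLFunctionNonsplitRiemannSumCertificateProofs`,
`PAdicLFunctionSplitRiemannSumCertificateProofs`; cc-typer-6) decide `‖[T^k]L‖` from ONE Riemann
sum `RS k n` through the truncation bound `‖[T^k]L − RS k n‖ ≤ (C/‖k!‖_p)·p⁻ⁿ` — the integral of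
the CONTINUOUS function `x ↦ (ℓ(x) choose k)` (Lipschitz constant `1/‖k!‖_p`). For a large index
`k` this asks for a deep level `n > v_p(k!) + log_p C` (e.g. `λ = 52` at `p = 7` needs `n ≥ 9`).
This file proves the classical ALGEBRAIC companion (Mazur–Tate–Teitelbaum 1986, §I.12–I.13 —
the level-`n` Riemann polynomials `P_n(T) = ∑_k RS k n · T^k` are compatible modulo
`ω_n(T) = (1+T)^{pⁿ} − 1`, and `ω_n ≡ T^{pⁿ} (mod p)`; this is how `L_p` is computed to a given
`(p, T)`-adic precision, cf. Stein–Wuthrich 2013, §3): for every index `k < pⁿ`,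

  `‖[T^k]L − RS k n‖ ≤ C · p⁻¹`,

so ONE Riemann sum with `C·p⁻¹ < ‖RS k n‖` certifies `‖[T^k]L‖ = ‖RS k n‖` and `[T^k]L ≠ 0` as
soon as `pⁿ > k` — for a `p`-integral symbol table (`C = 1`) and a unit Riemann sum this is
automatic. The mechanism is Lucas's theorem: refining `RS k n` to level `n + 1` along the
distribution relation, a class contributes `μ(u')·((s' choose k) − (s choose k))` with
`s' ≡ s (mod pⁿ)`, and `(s' choose k) ≡ (s choose k) (mod p)` because `k < pⁿ` only sees the `n`
lowest base-`p` digits (`norm_natCast_choose_sub_choose_le_inv_of_lt`). The one-step estimate is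
the tree's `norm_riemannSum_succ_sub_le_of_distribution` with the termwise bound made a parameter
(`norm_riemannSum_succ_sub_le_of_forall_choose`, same proof).

* abstract (any bounded distribution `μ` on `ℤ_p^×`): `norm_riemannSum_succ_sub_le_of_forall_choose`,
  `norm_riemannSum_sub_le_mul_inv_of_lt_pow`, `norm_limUnder_riemannSum_sub_le_mul_inv_of_lt_pow`,
  `norm_limUnder_riemannSum_eq_of_mul_inv_lt`;
* THE Mazur–Tate–Teitelbaum function at a multiplicative prime (every `L` of the package):
  `IsMultPAdicLFunctionOf.norm_coeff_sub_riemannSum_le_mul_inv_of_nonsplit` /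
  `….norm_coeff_eq_of_nonsplit_of_mul_inv_lt` (non-split, signed measure) and
  `IsSplitMultPAdicLFunctionOf.norm_coeff_sub_riemannSum_le_mul_inv_of_split` /
  `….norm_coeff_eq_of_split_of_mul_inv_lt` (split).

Use (cell `b2b-bsdres`, lane CLASS-CLOSURE, seat cc-typer-3 GEN 8; HONEST FRAMING: nothing about
any curve is asserted; the bound `C` and the inequality are hypotheses an instrument's exact symbol
table is EVIDENCE for; nothing booked): this is the kernel form of the (μ, λ)-census fold's "mod-`p`
reading" `[T^j](ϖ·L_p) ≡ b_j (mod p)`, `j < p^{n₀}` (HOME/class-closure/eng-6/n8-mu/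
INSTANTIATION-NOTE.md §3), under which the rows with a large `λ` are literal certificate instances
at the levels actually tabled.

References: [MazurTateTeitelbaum1986Invent] §I.11–I.13; [SteinWuthrich2013] §3 (the approximation
`P_n` and the ideal `(ω_n)`); Lucas 1878 (Mathlib
`Choose.choose_modEq_choose_mul_prod_range_choose`).
-/

noncomputable section

open Filter Topology
open scoped MatrixGroups ModularForm
open CongruenceSubgroup Literature.NumberTheory.EllipticCurves.ModularForms

namespace Literature.NumberTheory.EllipticCurves

variable {p : ℕ} [Fact p.Prime]

/-! ### Lucas: `(x choose k) ≡ (y choose k) (mod p)` for `x ≡ y (mod pⁿ)` and `k < pⁿ` -/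

omit [Fact p.Prime] in
/-- The `i`-th base-`p` digit of `x` only depends on `x mod p^n` for `i < n`. [folklore] -/
private theorem div_pow_mod_eq_of_modEq_pow {x y n i : ℕ} (h : x ≡ y [MOD p ^ n]) (hi : i < n) :
    x / p ^ i % p = y / p ^ i % p := by
  have h' : x % (p ^ i * p) = y % (p ^ i * p) := by
    rw [← pow_succ]
    exact Nat.ModEq.of_dvd (pow_dvd_pow p hi) h
  rw [← Nat.mod_mul_right_div_self, ← Nat.mod_mul_right_div_self, h']

/-- **Lucas**: if `x ≡ y (mod pⁿ)` and `k < pⁿ` then `(x choose k) ≡ (y choose k) (mod p)` — both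
sides are `∏_{i<n} (x_i choose k_i) (mod p)` with the same low digits, the digits of `k` above `n`
being `0` (Lucas 1878; Mathlib `Choose.choose_modEq_choose_mul_prod_range_choose`). [folklore] -/
private theorem intCast_choose_modEq_of_modEq_pow_of_lt {x y n k : ℕ} (h : x ≡ y [MOD p ^ n])
    (hk : k < p ^ n) : ((x.choose k : ℕ) : ℤ) ≡ ((y.choose k : ℕ) : ℤ) [ZMOD p] := by
  have hx := Choose.choose_modEq_choose_mul_prod_range_choose (n := x) (k := k) (p := p) n
  have hy := Choose.choose_modEq_choose_mul_prod_range_choose (n := y) (k := k) (p := p) n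
  rw [Nat.div_eq_of_lt hk, Nat.choose_zero_right, Nat.cast_one, one_mul] at hx hy
  have hprod : ∏ i ∈ Finset.range n, (x / p ^ i % p).choose (k / p ^ i % p) =
      ∏ i ∈ Finset.range n, (y / p ^ i % p).choose (k / p ^ i % p) :=
    Finset.prod_congr rfl fun i hi ↦ by rw [div_pow_mod_eq_of_modEq_pow h (Finset.mem_range.mp hi)]
  rw [hprod] at hx
  exact hx.trans hy.symm

/-- `‖(x choose k) − (y choose k)‖_p ≤ p⁻¹` for `x ≡ y (mod pⁿ)`, `k < pⁿ`. [folklore] -/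
private theorem norm_natCast_choose_sub_choose_le_inv_of_lt {x y n k : ℕ} (h : x ≡ y [MOD p ^ n])
    (hk : k < p ^ n) : ‖((x.choose k : ℕ) : ℚ_[p]) - (y.choose k : ℕ)‖ ≤ (p : ℝ)⁻¹ := by
  have hdvd : (p : ℤ) ∣ ((x.choose k : ℕ) : ℤ) - ((y.choose k : ℕ) : ℤ) :=
    (intCast_choose_modEq_of_modEq_pow_of_lt h hk).symm.dvd
  have hcast : ((x.choose k : ℕ) : ℚ_[p]) - (y.choose k : ℕ) =
      ((((x.choose k : ℕ) : ℤ) - ((y.choose k : ℕ) : ℤ) : ℤ) : ℚ_[p]) := by push_cast; rfl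
  rw [hcast, ← zpow_neg_one]
  exact (Padic.norm_int_le_pow_iff_dvd _ 1).mpr (by rwa [pow_one])

/-- From the tree's truncation bound `‖c − RS k m‖ ≤ (C/‖k!‖_p)·p^{−m}` (any constant in front),
the Riemann sums converge to `c`. [folklore] -/
private theorem tendsto_riemannSum_of_norm_sub_le {RS : ℕ → ℕ → ℚ_[p]} {c : ℚ_[p]} {K : ℝ} {k : ℕ}
    (h : ∀ m : ℕ, ‖c - RS k m‖ ≤ K * (p : ℝ) ^ (-m : ℤ)) :
    Tendsto (fun m ↦ RS k m) atTop (𝓝 c) := by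
  have hp1 : (1 : ℝ) < p := by exact_mod_cast (Fact.out : p.Prime).one_lt
  have hgeom : Tendsto (fun m : ℕ ↦ K * (p : ℝ) ^ (-m : ℤ)) atTop (𝓝 0) := by
    have h0 : Tendsto (fun m : ℕ ↦ ((p : ℝ)⁻¹) ^ m) atTop (𝓝 0) :=
      tendsto_pow_atTop_nhds_zero_of_lt_one (by positivity) (inv_lt_one_of_one_lt₀ hp1)
    have h1 : (fun m : ℕ ↦ K * (p : ℝ) ^ (-m : ℤ)) = fun m : ℕ ↦ K * ((p : ℝ)⁻¹) ^ m := by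
      funext m
      rw [zpow_neg, zpow_natCast, inv_pow]
    rw [h1, ← mul_zero K]
    exact h0.const_mul K
  rw [tendsto_iff_norm_sub_tendsto_zero]
  refine squeeze_zero (fun m ↦ norm_nonneg _) (fun m ↦ ?_) hgeom
  rw [norm_sub_rev]
  exact h m


/-! ### Abstract: the Riemann sums of a bounded distribution below degree `pⁿ` -/

section Abstract

variable {μ : (n : ℕ) → ZMod (p ^ n) → ℚ_[p]} {RS : ℕ → ℕ → ℚ_[p]}
  (hRS : ∀ k n : ℕ, RS k n =
      ∑ᶠ ξ : rootsOfUnity (torsionOrder p) ℤ_[p], ∑ s : ZMod (p ^ n),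
        μ (n + cyclotomicExponent p)
            (PadicInt.toZModPow (n + cyclotomicExponent p) ((ξ : ℤ_[p]ˣ) : ℤ_[p]) *
              (cyclotomicGenerator p : ZMod (p ^ (n + cyclotomicExponent p))) ^ s.val) *
          ((s.val.choose k : ℕ) : ℚ_[p]))

include hRS

/-- **One refinement step, with the termwise bound as a parameter** (the tree's
`norm_riemannSum_succ_sub_le_of_distribution`, same proof): if `μ` satisfies the distribution
relation and `‖μ‖ ≤ C`, and `‖(x choose k) − (y choose k)‖ ≤ B` whenever `x ≡ y (mod pⁿ)`, then
`‖RS k (n+1) − RS k n‖ ≤ C·B` — both sums live on `(ℤ/p^{n+1+e₀})^×` after refining `RS k n` along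
the distribution relation, and a class `u'` contributes `μ(u')·((s' choose k) − (s choose k))` with
`s' ≡ s (mod pⁿ)` its `γ`-exponents at the two levels. [cite: MazurTateTeitelbaum1986Invent, §I.11–I.13] -/
theorem norm_riemannSum_succ_sub_le_of_forall_choose
    (hdist : ∀ (n : ℕ) (a : ZMod (p ^ n)),
      ∑ b ∈ Finset.univ.filter (fun b : ZMod (p ^ (n + 1)) ↦
        ZMod.castHom (pow_dvd_pow p n.le_succ) (ZMod (p ^ n)) b = a), μ (n + 1) b = μ n a)
    {C : ℝ} (hC0 : 0 ≤ C) (hC : ∀ (n : ℕ) (a : ZMod (p ^ n)), ‖μ n a‖ ≤ C) (k n : ℕ) {B : ℝ}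
    (hB : ∀ x y : ℕ, x ≡ y [MOD p ^ n] → ‖((x.choose k : ℕ) : ℚ_[p]) - (y.choose k : ℕ)‖ ≤ B) :
    ‖RS k (n + 1) - RS k n‖ ≤ C * B := by
  classical
  haveI := neZero_torsionOrder p
  haveI := Fintype.ofFinite (rootsOfUnity (torsionOrder p) ℤ_[p])
  haveI : NeZero (p ^ n) := ⟨pow_ne_zero _ (Fact.out : p.Prime).ne_zero⟩
  haveI : NeZero (p ^ (n + 1)) := ⟨pow_ne_zero _ (Fact.out : p.Prime).ne_zero⟩
  -- the bijections `(ξ, s) ↦ ξ γ^s` at levels `n + e₀` and `n + 1 + e₀`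
  set Φ : rootsOfUnity (torsionOrder p) ℤ_[p] × ZMod (p ^ n) →
      (ZMod (p ^ (n + cyclotomicExponent p)))ˣ := fun x ↦ (isUnit_classMap p n x).unit with hΦ_def
  set Φ' : rootsOfUnity (torsionOrder p) ℤ_[p] × ZMod (p ^ (n + 1)) →
      (ZMod (p ^ (n + 1 + cyclotomicExponent p)))ˣ := fun x ↦ (isUnit_classMap p (n + 1) x).unit
    with hΦ'_def
  have hΦval : ∀ x, (Φ x : ZMod (p ^ (n + cyclotomicExponent p))) =
      PadicInt.toZModPow (n + cyclotomicExponent p) ((x.1 : ℤ_[p]ˣ) : ℤ_[p]) *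
        (cyclotomicGenerator p : ZMod (p ^ (n + cyclotomicExponent p))) ^ x.2.val := fun x ↦
    IsUnit.unit_spec _
  have hΦ'val : ∀ x, (Φ' x : ZMod (p ^ (n + 1 + cyclotomicExponent p))) =
      PadicInt.toZModPow (n + 1 + cyclotomicExponent p) ((x.1 : ℤ_[p]ˣ) : ℤ_[p]) *
        (cyclotomicGenerator p : ZMod (p ^ (n + 1 + cyclotomicExponent p))) ^ x.2.val := fun x ↦
    IsUnit.unit_spec _
  have hΦinj : Function.Injective Φ := fun x y hxy ↦ classMap_injective p n (by
    have h := congr_arg Units.val hxy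
    rwa [hΦval, hΦval] at h)
  have hΦ'inj : Function.Injective Φ' := fun x y hxy ↦ classMap_injective p (n + 1) (by
    have h := congr_arg Units.val hxy
    rwa [hΦ'val, hΦ'val] at h)
  have hΦbij : Function.Bijective Φ :=
    (Fintype.bijective_iff_injective_and_card Φ).mpr ⟨hΦinj, card_classDomain p n⟩
  have hΦ'bij : Function.Bijective Φ' :=
    (Fintype.bijective_iff_injective_and_card Φ').mpr ⟨hΦ'inj, card_classDomain p (n + 1)⟩
  set E := Equiv.ofBijective Φ hΦbij with hE_def
  set E' := Equiv.ofBijective Φ' hΦ'bij with hE'_def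
  -- the `γ`-exponent functions `(ℓ(·) choose k)`, extended by `0` to non-units
  set g : ZMod (p ^ (n + cyclotomicExponent p)) → ℚ_[p] := fun b ↦
    if h : IsUnit b then (((E.symm h.unit).2.val.choose k : ℕ) : ℚ_[p]) else 0 with hg_def
  set g' : ZMod (p ^ (n + 1 + cyclotomicExponent p)) → ℚ_[p] := fun b ↦
    if h : IsUnit b then (((E'.symm h.unit).2.val.choose k : ℕ) : ℚ_[p]) else 0 with hg'_def
  have hgΦ : ∀ x, g (Φ x) = ((x.2.val.choose k : ℕ) : ℚ_[p]) := by
    intro x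
    rw [hg_def]
    dsimp only
    rw [dif_pos (Units.isUnit _), IsUnit.unit_of_val_units]
    simp [hE_def]
  have hg'Φ' : ∀ x, g' (Φ' x) = ((x.2.val.choose k : ℕ) : ℚ_[p]) := by
    intro x
    rw [hg'_def]
    dsimp only
    rw [dif_pos (Units.isUnit _), IsUnit.unit_of_val_units]
    simp [hE'_def]
  -- `RS(k, n) = ∑_{u ∈ (ℤ/p^{n+e₀})^×} μ(u) g(u)` and similarly at level `n + 1`
  have hRSn : RS k n =
      ∑ u : (ZMod (p ^ (n + cyclotomicExponent p)))ˣ, μ (n + cyclotomicExponent p) u * g u := by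
    rw [hRS, ← finsum_sum_classes_eq_sum_units p n (fun b ↦ μ (n + cyclotomicExponent p) b * g b)]
    refine finsum_congr fun ξ ↦ Finset.sum_congr rfl fun s _ ↦ ?_
    rw [← hΦval (ξ, s), hgΦ]
  have hRSn' : RS k (n + 1) =
      ∑ u : (ZMod (p ^ (n + 1 + cyclotomicExponent p)))ˣ,
        μ (n + 1 + cyclotomicExponent p) u * g' u := by
    rw [hRS, ← finsum_sum_classes_eq_sum_units p (n + 1)
      (fun b ↦ μ (n + 1 + cyclotomicExponent p) b * g' b)]
    refine finsum_congr fun ξ ↦ Finset.sum_congr rfl fun s _ ↦ ?_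
    rw [← hΦ'val (ξ, s), hg'Φ']
  -- refine `RS(k, n)` to level `n + 1 + e₀` along the distribution relation
  have hle : n + cyclotomicExponent p ≤ n + 1 + cyclotomicExponent p := by omega
  have hdesc := sum_units_mul_of_distribution hdist (RingHom.id ℚ_[p])
    (m := n + cyclotomicExponent p) (L := n + 1 + cyclotomicExponent p)
    (le_add_of_le_right (Nat.pos_of_ne_zero (cyclotomicExponent_ne_zero p))) hle g
  simp only [RingHom.id_apply] at hdesc
  rw [hRSn, hRSn', ← hdesc, ← Finset.sum_sub_distrib]
  -- termwise estimate
  have hB0 : 0 ≤ B := (norm_nonneg _).trans (hB 0 0 (Nat.ModEq.refl 0))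
  refine IsUltrametricDist.norm_sum_le_of_forall_le_of_nonneg (mul_nonneg hC0 hB0) fun u' _ ↦ ?_
  obtain ⟨⟨θ, s'⟩, hx'⟩ := hΦ'bij.2 u'
  have hpow : (cyclotomicGenerator p : ZMod (p ^ (n + cyclotomicExponent p))) ^ (s'.val % p ^ n) =
      (cyclotomicGenerator p : ZMod (p ^ (n + cyclotomicExponent p))) ^ s'.val := by
    have h := pow_mod_orderOf (cyclotomicGenerator p : ZMod (p ^ (n + cyclotomicExponent p)))
      s'.val
    rwa [orderOf_cyclotomicGenerator p n] at h
  have hcast : Units.map (ZMod.castHom (pow_dvd_pow p hle)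
      (ZMod (p ^ (n + cyclotomicExponent p)))).toMonoidHom u' =
        Φ (θ, (s'.val : ZMod (p ^ n))) := by
    ext
    rw [Units.coe_map, hΦval, ← hx', hΦ'val]
    dsimp only
    rw [RingHom.toMonoidHom_eq_coe, MonoidHom.coe_coe, map_mul, map_pow,
      map_natCast (ZMod.castHom (pow_dvd_pow p hle) (ZMod (p ^ (n + cyclotomicExponent p)))),
      ZMod.castHom_apply, PadicInt.cast_toZModPow _ _ hle, ZMod.val_natCast, hpow]
  have hg'u : g' u' = ((s'.val.choose k : ℕ) : ℚ_[p]) := by rw [← hx', hg'Φ']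
  have hgu : g (ZMod.castHom (pow_dvd_pow p hle) (ZMod (p ^ (n + cyclotomicExponent p))) u') =
      (((s'.val % p ^ n).choose k : ℕ) : ℚ_[p]) := by
    have h1 : (ZMod.castHom (pow_dvd_pow p hle) (ZMod (p ^ (n + cyclotomicExponent p))) u' :
        ZMod (p ^ (n + cyclotomicExponent p))) =
        (Units.map (ZMod.castHom (pow_dvd_pow p hle)
          (ZMod (p ^ (n + cyclotomicExponent p)))).toMonoidHom u' :
          ZMod (p ^ (n + cyclotomicExponent p))) := by
      rw [Units.coe_map, RingHom.toMonoidHom_eq_coe, MonoidHom.coe_coe]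
    rw [h1, hcast, hgΦ]
    dsimp only
    rw [ZMod.val_natCast]
  have hΔ : ‖g' u' - g (ZMod.castHom (pow_dvd_pow p hle)
      (ZMod (p ^ (n + cyclotomicExponent p))) u')‖ ≤ B := by
    rw [hg'u, hgu]
    exact hB _ _ (Nat.mod_modEq _ _).symm
  rw [← mul_sub, norm_mul]
  exact mul_le_mul (hC _ _) hΔ (norm_nonneg _) hC0


/-- **The Riemann sums below degree `pⁿ` are constant modulo `C·p⁻¹`**: for `k < pⁿ` and `n ≤ m`,
`‖RS k m − RS k n‖ ≤ C·p⁻¹` (each step `m → m + 1` changes `RS k ·` by at most `C·p⁻¹`, by Lucas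
since `k < pⁿ ≤ p^m`; `ℚ_p` is ultrametric). Equivalently `P_m ≡ P_n (mod ω_n)` read modulo `p`
below degree `pⁿ`. [cite: MazurTateTeitelbaum1986Invent, §I.12–I.13] [cite: SteinWuthrich2013, §3] -/
theorem norm_riemannSum_sub_le_mul_inv_of_lt_pow
    (hdist : ∀ (n : ℕ) (a : ZMod (p ^ n)),
      ∑ b ∈ Finset.univ.filter (fun b : ZMod (p ^ (n + 1)) ↦
        ZMod.castHom (pow_dvd_pow p n.le_succ) (ZMod (p ^ n)) b = a), μ (n + 1) b = μ n a)
    {C : ℝ} (hC0 : 0 ≤ C) (hC : ∀ (n : ℕ) (a : ZMod (p ^ n)), ‖μ n a‖ ≤ C) {k n : ℕ}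
    (hk : k < p ^ n) {m : ℕ} (hnm : n ≤ m) :
    ‖RS k m - RS k n‖ ≤ C * (p : ℝ)⁻¹ := by
  have hp1 : (1 : ℝ) ≤ p := by exact_mod_cast (Fact.out : p.Prime).one_lt.le
  induction m, hnm using Nat.le_induction with
  | base =>
    rw [sub_self, norm_zero]
    positivity
  | succ m hnm ih =>
    have hkm : k < p ^ m := hk.trans_le (Nat.pow_le_pow_right (Fact.out : p.Prime).pos hnm)
    have hstep : ‖RS k (m + 1) - RS k m‖ ≤ C * (p : ℝ)⁻¹ :=
      norm_riemannSum_succ_sub_le_of_forall_choose hRS hdist hC0 hC k m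
        fun x y hxy ↦ norm_natCast_choose_sub_choose_le_inv_of_lt hxy hkm
    calc ‖RS k (m + 1) - RS k n‖ = ‖(RS k (m + 1) - RS k m) + (RS k m - RS k n)‖ := by
          rw [sub_add_sub_cancel]
      _ ≤ max ‖RS k (m + 1) - RS k m‖ ‖RS k m - RS k n‖ := IsUltrametricDist.norm_add_le_max _ _
      _ ≤ C * (p : ℝ)⁻¹ := max_le hstep ih

/-- **Congruence bound for the coefficients of the transform**: for `k < pⁿ`,
`‖c_k − RS k n‖ ≤ C·p⁻¹`, where `c_k = lim_m RS k m` is the `k`-th coefficient of the transform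
(`tendsto_riemannSum_of_distribution`; the closed ball is closed).
[cite: MazurTateTeitelbaum1986Invent, §I.12–I.13] [cite: SteinWuthrich2013, §3] -/
theorem norm_limUnder_riemannSum_sub_le_mul_inv_of_lt_pow
    (hdist : ∀ (n : ℕ) (a : ZMod (p ^ n)),
      ∑ b ∈ Finset.univ.filter (fun b : ZMod (p ^ (n + 1)) ↦
        ZMod.castHom (pow_dvd_pow p n.le_succ) (ZMod (p ^ n)) b = a), μ (n + 1) b = μ n a)
    {C : ℝ} (hC : ∀ (n : ℕ) (a : ZMod (p ^ n)), ‖μ n a‖ ≤ C) {k n : ℕ} (hk : k < p ^ n) :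
    ‖(limUnder atTop fun m ↦ RS k m) - RS k n‖ ≤ C * (p : ℝ)⁻¹ := by
  have hC0 : 0 ≤ C := (norm_nonneg _).trans (hC 0 0)
  have hlim : Tendsto (fun m ↦ RS k m - RS k n) atTop
      (𝓝 ((limUnder atTop fun m ↦ RS k m) - RS k n)) :=
    (tendsto_riemannSum_of_distribution hRS hdist hC k).sub tendsto_const_nhds
  refine le_of_tendsto hlim.norm ?_
  filter_upwards [eventually_ge_atTop n] with m hm
  exact norm_riemannSum_sub_le_mul_inv_of_lt_pow hRS hdist hC0 hC hk hm

/-- **Certificate modulo `p`** (abstract): if `k < pⁿ` and `C·p⁻¹ < ‖RS k n‖`, then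
`‖c_k‖ = ‖RS k n‖` and `c_k ≠ 0` (isosceles triangle). For a `p`-integral `μ` (`C = 1`) and a unit
Riemann sum this needs NO inequality beyond `pⁿ > k`. [cite: SteinWuthrich2013, §3]
[cite: MazurTateTeitelbaum1986Invent, §I.12–I.13] -/
theorem norm_limUnder_riemannSum_eq_of_mul_inv_lt
    (hdist : ∀ (n : ℕ) (a : ZMod (p ^ n)),
      ∑ b ∈ Finset.univ.filter (fun b : ZMod (p ^ (n + 1)) ↦
        ZMod.castHom (pow_dvd_pow p n.le_succ) (ZMod (p ^ n)) b = a), μ (n + 1) b = μ n a)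
    {C : ℝ} (hC : ∀ (n : ℕ) (a : ZMod (p ^ n)), ‖μ n a‖ ≤ C) {k n : ℕ} (hk : k < p ^ n)
    (hlt : C * (p : ℝ)⁻¹ < ‖RS k n‖) :
    ‖limUnder atTop fun m ↦ RS k m‖ = ‖RS k n‖ ∧ (limUnder atTop fun m ↦ RS k m) ≠ 0 := by
  have herr : ‖(limUnder atTop fun m ↦ RS k m) - RS k n‖ < ‖RS k n‖ :=
    (norm_limUnder_riemannSum_sub_le_mul_inv_of_lt_pow hRS hdist hC hk).trans_lt hlt
  have heq : ‖limUnder atTop fun m ↦ RS k m‖ = ‖RS k n‖ := by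
    have h := IsUltrametricDist.norm_add_eq_max_of_norm_ne_norm herr.ne
    rw [sub_add_cancel, max_eq_right herr.le] at h
    exact h
  refine ⟨heq, fun h0 ↦ ?_⟩
  have hC0 : 0 ≤ C := (norm_nonneg _).trans (hC 0 0)
  have hpos : 0 < ‖RS k n‖ := lt_of_le_of_lt (mul_nonneg hC0 (by positivity)) hlt
  rw [h0, norm_zero] at heq
  exact hpos.ne heq

end Abstract

/-! ### THE `p`-adic `L`-function at a NON-SPLIT multiplicative prime -/

section Nonsplit

variable {W : WeierstrassCurve ℚ} {N : ℕ} [NeZero N] {f : CuspForm (Gamma0 N) 2}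
  {RS : ℕ → ℕ → ℚ_[p]}
  (hRS : ∀ k n : ℕ, RS k n =
      ∑ᶠ ξ : rootsOfUnity (torsionOrder p) ℤ_[p], ∑ s : ZMod (p ^ n),
        (fun (n : ℕ) (a : ZMod (p ^ n)) ↦
            (-1 : ℚ_[p]) ^ n * (ratPlusSymbol f ((a.val : ℚ) / (p : ℚ) ^ n) : ℚ_[p]))
          (n + cyclotomicExponent p)
            (PadicInt.toZModPow (n + cyclotomicExponent p) ((ξ : ℤ_[p]ˣ) : ℤ_[p]) *
              (cyclotomicGenerator p : ZMod (p ^ (n + cyclotomicExponent p))) ^ s.val) *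
          ((s.val.choose k : ℕ) : ℚ_[p]))

include hRS

/-- **Congruence bound for THE non-split function**: for `f` the newform of `E = W/ℚ`, `p` non-split
multiplicative, any plus-symbol bound `C` and every `L` with `IsMultPAdicLFunctionOf f p (-1) L`:
`‖[T^k]L − RS k n‖ ≤ C·p⁻¹` for all `k < pⁿ` (`[T^k]L = lim_m RS k m` by the tree's truncation
bound; the signed measure `(−1)^m[a/p^m]⁺_f` satisfies the distribution relation, MTT §I.10 (10.2)
with `a_p = −1`). [cite: MazurTateTeitelbaum1986Invent, §I.10 Prop., §I.12–I.13] [cite: SteinWuthrich2013, §3] -/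
theorem IsMultPAdicLFunctionOf.norm_coeff_sub_riemannSum_le_mul_inv_of_nonsplit
    (hf : IsNewformOf W f) (hmult : W.HasMultiplicativeReductionAtPrime p)
    (hns : ¬ W.HasSplitMultiplicativeReductionAtPrime p) {C : ℝ}
    (hC : ∀ (n : ℕ) (a : ZMod (p ^ n)), ‖(ratPlusSymbol f ((a.val : ℚ) / (p : ℚ) ^ n) : ℚ_[p])‖ ≤ C)
    {L : PowerSeries ℚ_[p]} (hL : IsMultPAdicLFunctionOf f p (-1) L) {k n : ℕ} (hk : k < p ^ n) :
    ‖PowerSeries.coeff k L - RS k n‖ ≤ C * (p : ℝ)⁻¹ := by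
  have hQ : coeffField f = ⊥ := hf.coeffField_eq_bot
  have hrat : ∀ r : ℚ, (ratPlusSymbol f r : ℝ) = normalizedPlusSymbol f r :=
    ratCast_ratPlusSymbol_holds hf.1 hQ
  obtain ⟨hap, hpN⟩ := hf.cuspCoeff_eq_neg_one_and_dvd_of_nonsplit hmult hns
  have hfib := sum_fiber_ratPlusSymbol_eq_neg hrat hf.1 hpN hap
  have hdist : ∀ (n : ℕ) (a : ZMod (p ^ n)),
      ∑ b ∈ Finset.univ.filter (fun b : ZMod (p ^ (n + 1)) ↦
        ZMod.castHom (pow_dvd_pow p n.le_succ) (ZMod (p ^ n)) b = a),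
        (-1 : ℚ_[p]) ^ (n + 1) * (ratPlusSymbol f ((b.val : ℚ) / (p : ℚ) ^ (n + 1)) : ℚ_[p]) =
        (-1 : ℚ_[p]) ^ n * (ratPlusSymbol f ((a.val : ℚ) / (p : ℚ) ^ n) : ℚ_[p]) := by
    intro n a
    rw [← Finset.mul_sum, hfib n a]
    ring
  have hC' : ∀ (n : ℕ) (a : ZMod (p ^ n)),
      ‖(-1 : ℚ_[p]) ^ n * (ratPlusSymbol f ((a.val : ℚ) / (p : ℚ) ^ n) : ℚ_[p])‖ ≤ C := by
    intro n a
    rw [norm_mul, norm_pow, norm_neg, norm_one, one_pow, one_mul]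
    exact hC n a
  -- `[T^k]L = lim_m RS k m` (tree truncation bound + uniqueness of limits)
  have hto : Tendsto (fun m ↦ RS k m) atTop (𝓝 (PowerSeries.coeff k L)) :=
    tendsto_riemannSum_of_norm_sub_le
      (fun m ↦ hL.norm_coeff_sub_riemannSum_le_of_nonsplit hRS hf hmult hns hC k m)
  have hto' : Tendsto (fun m ↦ RS k m) atTop (𝓝 (limUnder atTop fun m ↦ RS k m)) :=
    tendsto_riemannSum_of_distribution
      (μ := fun n a ↦ (-1 : ℚ_[p]) ^ n * (ratPlusSymbol f ((a.val : ℚ) / (p : ℚ) ^ n) : ℚ_[p]))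
      hRS hdist hC' k
  rw [tendsto_nhds_unique hto hto']
  exact norm_limUnder_riemannSum_sub_le_mul_inv_of_lt_pow
    (μ := fun n a ↦ (-1 : ℚ_[p]) ^ n * (ratPlusSymbol f ((a.val : ℚ) / (p : ℚ) ^ n) : ℚ_[p]))
    hRS hdist hC' hk

/-- **Certificate modulo `p` for THE non-split function**: `k < pⁿ` and `C·p⁻¹ < ‖RS k n‖` ⟹
`‖[T^k]L‖ = ‖RS k n‖` and `[T^k]L ≠ 0`, for every `L` of the package. With a `p`-integral symbol
table (`C = 1`) and `‖RS k n‖ = 1` the inequality is `p⁻¹ < 1`: the (μ, λ)-fold's mod-`p` reading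
`[T^k]L ≡ RS k n (mod p)` in kernel form. [cite: SteinWuthrich2013, §3 and §4.2]
[cite: MazurTateTeitelbaum1986Invent, §I.10 Prop., §I.12–I.13] -/
theorem IsMultPAdicLFunctionOf.norm_coeff_eq_of_nonsplit_of_mul_inv_lt
    (hf : IsNewformOf W f) (hmult : W.HasMultiplicativeReductionAtPrime p)
    (hns : ¬ W.HasSplitMultiplicativeReductionAtPrime p) {C : ℝ}
    (hC : ∀ (n : ℕ) (a : ZMod (p ^ n)), ‖(ratPlusSymbol f ((a.val : ℚ) / (p : ℚ) ^ n) : ℚ_[p])‖ ≤ C)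
    {L : PowerSeries ℚ_[p]} (hL : IsMultPAdicLFunctionOf f p (-1) L) {k n : ℕ} (hk : k < p ^ n)
    (hlt : C * (p : ℝ)⁻¹ < ‖RS k n‖) :
    ‖PowerSeries.coeff k L‖ = ‖RS k n‖ ∧ PowerSeries.coeff k L ≠ 0 := by
  have herr : ‖PowerSeries.coeff k L - RS k n‖ < ‖RS k n‖ :=
    (hL.norm_coeff_sub_riemannSum_le_mul_inv_of_nonsplit hRS hf hmult hns hC hk).trans_lt hlt
  have heq : ‖PowerSeries.coeff k L‖ = ‖RS k n‖ := by
    have h := IsUltrametricDist.norm_add_eq_max_of_norm_ne_norm herr.ne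
    rw [sub_add_cancel, max_eq_right herr.le] at h
    exact h
  refine ⟨heq, fun h0 ↦ ?_⟩
  have hC0 : 0 ≤ C := (norm_nonneg _).trans (hC 0 0)
  have hpos : 0 < ‖RS k n‖ := lt_of_le_of_lt (mul_nonneg hC0 (by positivity)) hlt
  rw [h0, norm_zero] at heq
  exact hpos.ne heq

end Nonsplit

/-! ### THE `p`-adic `L`-function at a SPLIT multiplicative prime -/

section Split

variable {W : WeierstrassCurve ℚ} {N : ℕ} [NeZero N] {f : CuspForm (Gamma0 N) 2}
  {RS : ℕ → ℕ → ℚ_[p]}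
  (hRS : ∀ k n : ℕ, RS k n =
      ∑ᶠ ξ : rootsOfUnity (torsionOrder p) ℤ_[p], ∑ s : ZMod (p ^ n),
        (fun (n : ℕ) (a : ZMod (p ^ n)) ↦ (ratPlusSymbol f ((a.val : ℚ) / (p : ℚ) ^ n) : ℚ_[p]))
          (n + cyclotomicExponent p)
            (PadicInt.toZModPow (n + cyclotomicExponent p) ((ξ : ℤ_[p]ˣ) : ℤ_[p]) *
              (cyclotomicGenerator p : ZMod (p ^ (n + cyclotomicExponent p))) ^ s.val) *
          ((s.val.choose k : ℕ) : ℚ_[p]))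

include hRS

/-- **Congruence bound for THE split function**: `p` split multiplicative, any plus-symbol bound
`C`, every `L` with `IsSplitMultPAdicLFunctionOf f p L`: `‖[T^k]L − RS k n‖ ≤ C·p⁻¹` for `k < pⁿ`
(distribution relation MTT §I.10 (10.2) with `a_p = 1`). [cite: MazurTateTeitelbaum1986Invent, §I.10 Prop., §I.12–I.13, §I.15]
[cite: SteinWuthrich2013, §3] -/
theorem IsSplitMultPAdicLFunctionOf.norm_coeff_sub_riemannSum_le_mul_inv_of_split
    (hsplit : W.HasSplitMultiplicativeReductionAtPrime p) (hf : IsNewformOf W f) {C : ℝ}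
    (hC : ∀ (n : ℕ) (a : ZMod (p ^ n)), ‖(ratPlusSymbol f ((a.val : ℚ) / (p : ℚ) ^ n) : ℚ_[p])‖ ≤ C)
    {L : PowerSeries ℚ_[p]} (hL : IsSplitMultPAdicLFunctionOf f p L) {k n : ℕ} (hk : k < p ^ n) :
    ‖PowerSeries.coeff k L - RS k n‖ ≤ C * (p : ℝ)⁻¹ := by
  have hQ : coeffField f = ⊥ := hf.coeffField_eq_bot
  have hrat : ∀ r : ℚ, (ratPlusSymbol f r : ℝ) = normalizedPlusSymbol f r :=
    ratCast_ratPlusSymbol_holds hf.1 hQ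
  have hap : cuspCoeff f p = 1 := (hf.cuspCoeff_eq_one_and_sq_of_split hsplit).1
  have hpN : p ∣ N := hf.dvd_level_of_split hsplit
  have hdist := sum_fiber_ratPlusSymbol_eq hrat hf.1 hpN hap
  have hto : Tendsto (fun m ↦ RS k m) atTop (𝓝 (PowerSeries.coeff k L)) :=
    tendsto_riemannSum_of_norm_sub_le
      (fun m ↦ hL.norm_coeff_sub_riemannSum_le_of_split hRS hsplit hf hC k m)
  have hto' : Tendsto (fun m ↦ RS k m) atTop (𝓝 (limUnder atTop fun m ↦ RS k m)) :=
    tendsto_riemannSum_of_distribution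
      (μ := fun n a ↦ (ratPlusSymbol f ((a.val : ℚ) / (p : ℚ) ^ n) : ℚ_[p])) hRS hdist hC k
  rw [tendsto_nhds_unique hto hto']
  exact norm_limUnder_riemannSum_sub_le_mul_inv_of_lt_pow
    (μ := fun n a ↦ (ratPlusSymbol f ((a.val : ℚ) / (p : ℚ) ^ n) : ℚ_[p])) hRS hdist hC hk

/-- **Certificate modulo `p` for THE split function**: `k < pⁿ` and `C·p⁻¹ < ‖RS k n‖` ⟹
`‖[T^k]L‖ = ‖RS k n‖` and `[T^k]L ≠ 0`, for every `L` of the package. [cite: SteinWuthrich2013, §3 and §4.2]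
[cite: MazurTateTeitelbaum1986Invent, §I.10 Prop., §I.12–I.13, §I.15] -/
theorem IsSplitMultPAdicLFunctionOf.norm_coeff_eq_of_split_of_mul_inv_lt
    (hsplit : W.HasSplitMultiplicativeReductionAtPrime p) (hf : IsNewformOf W f) {C : ℝ}
    (hC : ∀ (n : ℕ) (a : ZMod (p ^ n)), ‖(ratPlusSymbol f ((a.val : ℚ) / (p : ℚ) ^ n) : ℚ_[p])‖ ≤ C)
    {L : PowerSeries ℚ_[p]} (hL : IsSplitMultPAdicLFunctionOf f p L) {k n : ℕ} (hk : k < p ^ n)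
    (hlt : C * (p : ℝ)⁻¹ < ‖RS k n‖) :
    ‖PowerSeries.coeff k L‖ = ‖RS k n‖ ∧ PowerSeries.coeff k L ≠ 0 := by
  have herr : ‖PowerSeries.coeff k L - RS k n‖ < ‖RS k n‖ :=
    (hL.norm_coeff_sub_riemannSum_le_mul_inv_of_split hRS hsplit hf hC hk).trans_lt hlt
  have heq : ‖PowerSeries.coeff k L‖ = ‖RS k n‖ := by
    have h := IsUltrametricDist.norm_add_eq_max_of_norm_ne_norm herr.ne
    rw [sub_add_cancel, max_eq_right herr.le] at h
    exact h
  refine ⟨heq, fun h0 ↦ ?_⟩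
  have hC0 : 0 ≤ C := (norm_nonneg _).trans (hC 0 0)
  have hpos : 0 < ‖RS k n‖ := lt_of_le_of_lt (mul_nonneg hC0 (by positivity)) hlt
  rw [h0, norm_zero] at heq
  exact hpos.ne heq

end Split

end Literature.NumberTheory.EllipticCurves

end
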